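import Literature.NumberTheory.Automorphic.Liu2021.LemD1AsPrintedIndexedNonVacuityTorsionCarrier
import HarnessLib

/-!
# [Liu2021, App. D Lemma D.1 (1) ∧ (3)] AS PRINTED with the `μ`-conjunct ALONE separating ABOVE the primes dividing `N`:
# the WILD CARRIER `Ψ = θ ∘ det` from a global norm-one principal unit — ANY quadratic `E/F`; and the ALL-PLACES synthesis for `ζ_3 ∈ L`

Reproduction ∕ bookkeeping (Literature, THEOREMS ONLY: no definition, no record, no named fact, no `sorry`; nothing is
asserted about Liu's oscillator representations or about the tree's constructed local Weil carriers).

Sequel of `LemD1AsPrintedIndexedNonVacuityTorsionCarrier.lean` (the `μ`-alone model at the non-split places AWAY from the order of a norm-one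
root of unity `ζ ∈ E`) and of `…DetCarrier.lean` (every split place), whose «What this does NOT give» name «the places above the order of
`ζ`» and «a quadratic `E/F` with NO norm-one torsion … then the question is whether `(E_w¹ : (E_w¹)^N) > 1`, i.e. `p ∣ N` or …».  THIS FILE
settles the case `p ∣ N`, i.e. the non-split places `w` with `v_w(N) < 1`, for ANY quadratic extension `E/F` of number fields — no root of
unity needed: the principal units of `E_w¹` are an infinite pro-`p` source of `N`-torsion in the finite quotients.

* §1 (local, any place `w` of a number field `E`) **`valued_pow_sub_one_lt`**: `v_w(N) < 1` and `0 < ord_w(y − 1) < ∞` ⇒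
  `v_w(y^N − 1) < v_w(y − 1)` (`y^N − 1 = (y − 1) Σ_{i<N} y^i`, `Σ_{i<N} y^i = N + Σ_{i<N}(y^i − 1)` of valuation `< 1`); and
  **`exists_character_pow_eq_one_of_level`** — the finite-group lemma of `…TorsionCarrier` §1 at a general LEVEL: for a subgroup `A ≤ E_wˣ` of
  `w`-units and `ζ ∈ A` with `v_w(ζ^N − 1) < v_w(ζ − 1) = γ ≠ 0`, a character `θ : A → μ_N` trivial on `{v_w(x − 1) < γ}`, `θ ≠ 1`
  (`𝒪_wˣ / U_γ` finite — `𝒪_w` compact, `U_γ` open —, the class of `ζ` in the image `A'` of `A` is `≠ 1` and killed by `N`, so the `N`-th power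
  map of the finite group `A'` is not injective, hence not onto; a character of `A'/A'^N`). [NeukirchANT1999, Ch. II §3 (3.10), §5 (5.3)]
* §2 (place model of a quadratic `E/F` at `v`, any `w ∣ v`) **`exists_mul_conj_eq_one_valuation_sub_one_lt`**: a GLOBAL norm-one principal
  unit `a = (1 + u)/(1 − u) ∈ E`, `u = δ π^k` skew (`c u = −u`, `π ∈ 𝔭_v ∖ 0`, `k` large): `a · c(a) = 1`, `0 < ord_w(a − 1) < ∞`
  (`a − 1 = 2u/(1 − u)`); and at a NON-SPLIT `w` with `v_w(N) < 1` **`exists_wild_carrier_character`**: `Ψ = θ ∘ det : U(V)(F_v) → μ_N` with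
  `Ψ ∘ S.scalar = 1`, `Ψ = 1` on the open `{g : v_w(det(g)_w − 1) < v_w(a − 1)}`, `Ψ(g₀) ≠ 1` (`det` onto `E_v¹`, `…DetCarrier.exists_mem_U_det_eq`;
  norm-one ⇒ `w`-unit, `…InertRigidity.valued_mul_conjLocal_apply`).
* §3 **`exists_lemD1IndexedFamily_item1_and_lemD1_3_mu_of_wild`** — EVERY place `w ∣ v` with `v_w(N) < 1` (split via `…DetCarrier`), every
  `N ≥ 3`, ANY `E/F`, every `μ ∈ MuSet S`, every `e`: labels `(μ, e, 1)`, `(μ', e, 1)`, carriers the trivial line and the line of `Ψ`; (1)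
  member by member ∧ (3) for all four pairs, only the `μ`-conjunct failing; hypothesis-free (`…NormClassExtensionDyadic.nonempty_muSet`)
  **`not_forall_mu_eq_of_sameClass_of_chi_eq_of_wild`**, **`not_forall_areIsomorphicRep_of_chi_eq_of_wild`**.
* §4 the CM rows (ANY CM field `L`): `…localMu_mu_of_wild`, `…isCMField_of_wild` ×2, and for `3 ∣ N` at the places ABOVE `3`:
  **`not_forall_mu_eq_of_sameClass_of_chi_eq_of_isCMField_of_three_mem`** ∕ `…areIsomorphicRep…_of_three_mem`.
* §5 SYNTHESIS with `…TorsionCarrier`'s cube-root theorem (places `∤ 3`): for a CM field `L ∋ ζ_3` (`ζ² + ζ + 1 = 0`) and `3 ∣ N`, `N ≥ 3`,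
  **`forall_not_forall_mu_eq_of_sameClass_of_chi_eq_of_isCMField_of_cubeRoot`** ∕ `forall_not_forall_areIsomorphicRep_of_chi_eq_of_isCMField_of_cubeRoot`:
  at EVERY finite place `v` of `L⁺` the records `hD1''` ∕ `hD3` do not force «same `ε`-class ∧ same `χ` ⟹ same `μ`», nor «same `χ` ⟹ isomorphic
  `ω`'s» — the `μ`-conjunct of (3) is independent of the other two EVERYWHERE for such `L` (e.g. `L = ℚ(ζ_9)`).

What this does NOT give: the `μ`-alone model at a non-split place `w` with `v_w(N) = 1` of a quadratic `E/F` carrying no norm-one root of unity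
of order dividing `N` other than `1` off `w` (there `(E_w¹ : (E_w¹)^N)` is governed by `gcd(N, |κ_w¹|)` at inert `w`, resp. is `1` for `N` odd at
ramified `w` — place by place, not treated); anything about the rows' OWN carriers `𝓢.omegaLoc v`; Lem. D.1 itself.  HC_CM is NOT proved.

Cell pub-hodgecm2 (COR-CM), audit class of the END rows `hD1''` ∕ `hD3`; seat prover-pub-hodgecm2-b10.

References: [Liu2021] Y. Liu, *Fourier–Jacobi cycles and arithmetic relative trace formula*, Camb. J. Math. 9 (2021) =
arXiv:2102.11518, App. D §D.1 (l. 5213–5221), Lemma D.1 (1) (l. 5229), (3) (l. 5233), Def. 4.11 (l. 2086); [Mok2014] C. P. Mok,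
Mem. AMS 235 (2015), §1 Notation p. 5; [NeukirchANT1999] J. Neukirch, *Algebraic Number Theory* (1999), Ch. II §3 Prop. (3.10) (the
higher unit groups `U^{(n)}`, `𝒪^*/U^{(n)}` finite), Ch. II §5 Prop. (5.3) and (5.5) (the structure of `U^{(1)}`; `p`-th powers raise the
level); [CasselsFrohlichANT1967] Ch. II §10 (`L ⊗_K K_v`), Ch. VII §1.1; [WeilBNT1967] A. Weil, *Basic Number Theory*, Ch. I §4.
-/

noncomputable section

open scoped Matrix MatrixGroups
open NumberField IsDedekindDomain
open Literature.RepresentationTheory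
open Literature.RepresentationTheory.Liu2021 (OscillatorStandingData)
open Literature.RepresentationTheory.CentralCharacterQuotient (augmentation quotRep quotRep_mk)
open Literature.NumberTheory.GaloisRepresentations (HeckeCharacter)

namespace Literature.NumberTheory.Automorphic.Liu2021.LemD1IndexedNonVacuityWildCarrier

open UnitaryGroup

/-! ## §1 Local: powers of principal units at a place above a prime dividing `N`; a character `θ` with `θ^N = 1`, `θ ≠ 1` of a group of
`w`-units from an element `ζ` with `v_w(ζ^N − 1) < v_w(ζ − 1)` -/

section Local

variable {E : Type} [Field E] [NumberField E] (w : HeightOneSpectrum (𝓞 E))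

/-- **the unit-part homomorphism `E_wˣ → 𝒪_wˣ`, `x ↦ x · ϖ_w^{ord_w x}`**, the identity on `𝒪_wˣ` (copy of the private lemma of the
siblings). [cite: NeukirchANT1999, Ch. II §5 Prop. (5.3)] -/
private theorem exists_unitPart :
    ∃ υ : (w.adicCompletion E)ˣ →* (w.adicCompletionIntegers E).unitGroup,
      ∀ x : (w.adicCompletion E)ˣ, Valued.v (x : w.adicCompletion E) = 1 →
        ((υ x : (w.adicCompletionIntegers E).unitGroup) : (w.adicCompletion E)ˣ) = x := by
  set ϖ : (w.adicCompletion E)ˣ := HeckeCharacter.uniformizer E w with hϖdef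
  have hϖ : Valued.v (ϖ : w.adicCompletion E) = WithZero.exp (-1 : ℤ) := HeckeCharacter.valued_uniformizer w
  have hne : ∀ x : (w.adicCompletion E)ˣ, Valued.v (x : w.adicCompletion E) ≠ 0 := fun x =>
    (Valuation.ne_zero_iff _).2 x.ne_zero
  let f : (w.adicCompletion E)ˣ →* (w.adicCompletion E)ˣ :=
    { toFun := fun x => x * ϖ ^ WithZero.log (Valued.v (x : w.adicCompletion E))
      map_one' := by rw [Units.val_one, map_one, WithZero.log_one, zpow_zero, one_mul]
      map_mul' := fun x y => by
        rw [Units.val_mul, map_mul, WithZero.log_mul (hne x) (hne y), zpow_add, mul_mul_mul_comm] }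
  have hf : ∀ x, Valued.v ((f x : (w.adicCompletion E)ˣ) : w.adicCompletion E) = 1 := by
    intro x
    change Valued.v (((x * ϖ ^ WithZero.log (Valued.v (x : w.adicCompletion E)) : (w.adicCompletion E)ˣ)) :
      w.adicCompletion E) = 1
    obtain ⟨m, hm⟩ : ∃ m : ℤ, Valued.v (x : w.adicCompletion E) = WithZero.exp m :=
      ⟨_, (WithZero.exp_log (hne x)).symm⟩
    rw [Units.val_mul, Units.val_zpow_eq_zpow_val, map_mul, map_zpow₀, hϖ, ← WithZero.exp_zsmul, smul_eq_mul,
      mul_neg, mul_one, hm, WithZero.log_exp, ← WithZero.exp_add, add_neg_cancel, WithZero.exp_zero]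
  refine ⟨MonoidHom.codRestrict f _ fun x => (Valuation.mem_unitGroup_iff _ Valued.v (f x)).2 (hf x), fun x hx => ?_⟩
  rw [MonoidHom.codRestrict_apply]
  change x * ϖ ^ WithZero.log (Valued.v (x : w.adicCompletion E)) = x
  rw [hx, WithZero.log_one, zpow_zero, mul_one]

/-- the «level set» `{y : v_w(y − 1) < v_w(t)}` is open in `E_w`. [cite: NeukirchANT1999, Ch. II §3, before Prop. (3.10)] -/
private theorem isOpen_setOf_valued_sub_one_lt (t : w.adicCompletion E) :
    IsOpen {y : w.adicCompletion E | Valued.v (y - 1) < Valued.v t} := by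
  have h := (Valued.isOpen_ball (w.adicCompletion E) (Valued.v.restrict t)).preimage
    (show Continuous fun y : w.adicCompletion E => y - 1 from continuous_id.sub continuous_const)
  convert h using 1
  ext y
  simp only [Set.mem_setOf_eq, Set.mem_preimage, Valuation.restrict_lt_iff]

/-- **powers of principal units above a prime dividing `N`**: if `v_w(N) < 1` and `0 < v_w(y − 1) < 1` then `v_w(y^N − 1) < v_w(y − 1)`
(`y^N − 1 = (y − 1) · Σ_{i<N} y^i` and `Σ_{i<N} y^i = N + Σ_{i<N} (y^i − 1)` has valuation `< 1`). [cite: NeukirchANT1999, Ch. II §3 Prop. (3.10)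
and §5 (5.5) (the `p`-th power map on the higher unit groups)] -/
theorem valued_pow_sub_one_lt {N : ℕ} (hN : Valued.v ((N : w.adicCompletion E)) < 1) {y : w.adicCompletion E}
    (hy0 : Valued.v (y - 1) ≠ 0) (hy1 : Valued.v (y - 1) < 1) :
    Valued.v (y ^ N - 1) < Valued.v (y - 1) := by
  have hy : Valued.v y = 1 := by
    have := Valuation.map_one_add_of_lt Valued.v hy1
    rwa [add_sub_cancel] at this
  -- `v(y^i − 1) ≤ v(y − 1)`
  have hpow : ∀ i : ℕ, Valued.v (y ^ i - 1) ≤ Valued.v (y - 1) := fun i => by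
    rw [← geom_sum_mul, Valuation.map_mul]
    have hS : Valued.v (∑ j ∈ Finset.range i, y ^ j) ≤ 1 :=
      Valuation.map_sum_le _ fun j _ => by rw [Valuation.map_pow, hy, one_pow]
    exact mul_le_of_le_one_left' hS
  -- `Σ_{i<N} y^i = N + Σ_{i<N} (y^i − 1)`
  have hsplit : (∑ i ∈ Finset.range N, y ^ i) = (N : w.adicCompletion E) + ∑ i ∈ Finset.range N, (y ^ i - 1) := by
    rw [Finset.sum_sub_distrib, Finset.sum_const, Finset.card_range, nsmul_eq_mul, mul_one, add_sub_cancel]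
  have hS : Valued.v (∑ i ∈ Finset.range N, y ^ i) < 1 := by
    rw [hsplit]
    refine (Valuation.map_add _ _ _).trans_lt (max_lt hN ?_)
    exact (Valuation.map_sum_le _ fun i _ => hpow i).trans_lt hy1
  rw [← geom_sum_mul, Valuation.map_mul]
  exact mul_lt_of_lt_one_left (zero_lt_iff.2 hy0) hS

/-- **a character of order dividing `N`, non-trivial, from a unit `ζ` with `v_w(ζ^N − 1) < v_w(ζ − 1) = γ`**: for a subgroup `A` of `E_wˣ`
consisting of `w`-units and such a `ζ ∈ A`, there is `θ : A → ℂˣ` with `θ^N = 1`, `θ = 1` on `{x ∈ A : v_w(x − 1) < γ}`, `θ ≠ 1`.  PROOF: `𝒪_w`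
compact, `U_γ = {v_w(u − 1) < γ}` an open subgroup, `𝒪_wˣ / U_γ` FINITE; in the image `A'` of `A` the class of `ζ` is `≠ 1` and killed by
`N` (`ζ^N ∈ U_γ`), so the `N`-th power endomorphism of the finite group `A'` is not injective, hence not surjective, and `A'/A'^N` has a
non-trivial character. [cite: NeukirchANT1999, Ch. II §3 Prop. (3.10) and Ch. II §5 Prop. (5.3)] -/
theorem exists_character_pow_eq_one_of_level {N : ℕ} (hN : N ≠ 0) (A : Subgroup (w.adicCompletion E)ˣ)
    (hA : ∀ x ∈ A, Valued.v ((x : (w.adicCompletion E)ˣ) : w.adicCompletion E) = 1)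
    {ζ : (w.adicCompletion E)ˣ} (hζA : ζ ∈ A) (hζ0 : Valued.v ((ζ : w.adicCompletion E) - 1) ≠ 0)
    (hζN : Valued.v (((ζ ^ N : (w.adicCompletion E)ˣ) : w.adicCompletion E) - 1) < Valued.v ((ζ : w.adicCompletion E) - 1)) :
    ∃ θ : A →* ℂˣ, (∀ x, θ x ^ N = 1) ∧ (∀ x, ‖((θ x : ℂˣ) : ℂ)‖ = 1) ∧
      (∀ x : A, Valued.v (((x : (w.adicCompletion E)ˣ) : w.adicCompletion E) - 1) < Valued.v ((ζ : w.adicCompletion E) - 1) → θ x = 1) ∧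
      ∃ x, θ x ≠ 1 := by
  classical
  set γ := Valued.v ((ζ : w.adicCompletion E) - 1) with hγ
  obtain ⟨υ, hυ⟩ := exists_unitPart w
  haveI : CompactSpace (w.adicCompletionIntegers E) :=
    Literature.NumberTheory.Automorphic.compactSpace_adicCompletionIntegers' E w
  set e : (w.adicCompletionIntegers E).unitGroup ≃* (w.adicCompletionIntegers E)ˣ :=
    (w.adicCompletionIntegers E).unitGroupMulEquiv with he
  have hecoe : ∀ a : (w.adicCompletionIntegers E).unitGroup,
      (((e a : (w.adicCompletionIntegers E)ˣ) : w.adicCompletionIntegers E) : w.adicCompletion E) =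
        ((a : (w.adicCompletion E)ˣ) : w.adicCompletion E) := fun a => by
    rw [he, ValuationSubring.coe_unitGroupMulEquiv_apply]
  have hle : ∀ u : (w.adicCompletionIntegers E)ˣ,
      Valued.v (((u : w.adicCompletionIntegers E)) : w.adicCompletion E) ≤ 1 := fun u =>
    (Valuation.mem_valuationSubring_iff _ _).1 (u : w.adicCompletionIntegers E).2
  -- the level subgroup `U_γ = {u : v(u - 1) < γ}` of `𝒪_wˣ`
  obtain ⟨H, hHmem⟩ : ∃ H : Subgroup (w.adicCompletionIntegers E)ˣ, ∀ u : (w.adicCompletionIntegers E)ˣ, u ∈ H ↔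
      Valued.v ((((u : w.adicCompletionIntegers E)) : w.adicCompletion E) - 1) < γ :=
    ⟨{ carrier := {u | Valued.v ((((u : w.adicCompletionIntegers E)) : w.adicCompletion E) - 1) < γ}
       mul_mem' := fun {a b} ha hb => by
         simp only [Set.mem_setOf_eq] at ha hb ⊢
         rw [Units.val_mul, MulMemClass.coe_mul]
         have hsplit : (((a : w.adicCompletionIntegers E)) : w.adicCompletion E) *
               (((b : w.adicCompletionIntegers E)) : w.adicCompletion E) - 1 =
             (((a : w.adicCompletionIntegers E)) : w.adicCompletion E) *
               ((((b : w.adicCompletionIntegers E)) : w.adicCompletion E) - 1) +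
               ((((a : w.adicCompletionIntegers E)) : w.adicCompletion E) - 1) := by ring
         rw [hsplit]
         refine (Valuation.map_add _ _ _).trans_lt (max_lt ?_ ha)
         rw [Valuation.map_mul]
         exact mul_lt_of_le_one_of_lt (hle a) hb
       one_mem' := by
         simp only [Set.mem_setOf_eq, Units.val_one, OneMemClass.coe_one, sub_self, Valuation.map_zero]
         exact zero_lt_iff.2 hζ0
       inv_mem' := fun {a} ha => by
         simp only [Set.mem_setOf_eq] at ha ⊢
         have hinv : (((a⁻¹ : (w.adicCompletionIntegers E)ˣ) : w.adicCompletionIntegers E) : w.adicCompletion E) *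
             (((a : w.adicCompletionIntegers E)) : w.adicCompletion E) = 1 := by
           rw [← MulMemClass.coe_mul, ← Units.val_mul, inv_mul_cancel, Units.val_one, OneMemClass.coe_one]
         have hrw : (((a⁻¹ : (w.adicCompletionIntegers E)ˣ) : w.adicCompletionIntegers E) : w.adicCompletion E) - 1 =
             (((a⁻¹ : (w.adicCompletionIntegers E)ˣ) : w.adicCompletionIntegers E) : w.adicCompletion E) *
               (1 - (((a : w.adicCompletionIntegers E)) : w.adicCompletion E)) := by
           rw [mul_sub, mul_one, hinv]
         rw [hrw, Valuation.map_mul, Valuation.map_sub_swap]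
         exact mul_lt_of_le_one_of_lt (hle a⁻¹) ha }, fun u => Iff.rfl⟩
  have hHopen : IsOpen (H : Set (w.adicCompletionIntegers E)ˣ) := by
    have h := (isOpen_setOf_valued_sub_one_lt w ((ζ : w.adicCompletion E) - 1)).preimage
      (show Continuous fun u : (w.adicCompletionIntegers E)ˣ => (((u : w.adicCompletionIntegers E)) : w.adicCompletion E) from
        continuous_subtype_val.comp Units.continuous_val)
    convert h using 1
    ext u
    rw [SetLike.mem_coe, hHmem, Set.mem_preimage, Set.mem_setOf_eq]
  haveI : Finite ((w.adicCompletionIntegers E)ˣ ⧸ H) := Subgroup.quotient_finite_of_isOpen H hHopen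
  -- `ρ : E_wˣ → 𝒪_wˣ / U_γ` (unit part, then class)
  let ρ : (w.adicCompletion E)ˣ →* (w.adicCompletionIntegers E)ˣ ⧸ H := (QuotientGroup.mk' H).comp (e.toMonoidHom.comp υ)
  have hρ : ∀ x, ρ x = QuotientGroup.mk (e (υ x)) := fun x => rfl
  have hρ1 : ∀ x : (w.adicCompletion E)ˣ, Valued.v (x : w.adicCompletion E) = 1 →
      (ρ x = 1 ↔ Valued.v ((x : w.adicCompletion E) - 1) < γ) := fun x hx => by
    rw [hρ, QuotientGroup.eq_one_iff, hHmem, hecoe, hυ x hx]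
  -- characters of order dividing `N` on a finite abelian group with non-injective `N`-th power map (abstract statement)
  have key : ∀ (G : Type) [CommGroup G] [Finite G] (a : G), a ≠ 1 → a ^ N = 1 →
      ∃ φ : G →* ℂˣ, (∀ x, φ x ^ N = 1) ∧ ∃ x, φ x ≠ 1 := fun G _ _ a ha haN => by
    have hnotinj : ¬ Function.Injective (powMonoidHom N : G →* G) := fun hinj =>
      ha (hinj (by rw [powMonoidHom_apply, powMonoidHom_apply, haN, one_pow]))
    have hnotsurj : ¬ Function.Surjective (powMonoidHom N : G →* G) := fun hs =>
      hnotinj (Finite.injective_iff_surjective.2 hs)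
    obtain ⟨b, hb⟩ := not_forall.1 hnotsurj
    have hbR : b ∉ (powMonoidHom N : G →* G).range := fun h => hb (MonoidHom.mem_range.1 h)
    have hmk : (QuotientGroup.mk b : G ⧸ (powMonoidHom N : G →* G).range) ≠ 1 := by
      rw [Ne, QuotientGroup.eq_one_iff]
      exact hbR
    obtain ⟨φ₀, hφ₀⟩ := CommGroup.exists_apply_ne_one_of_hasEnoughRootsOfUnity (G ⧸ (powMonoidHom N : G →* G).range) ℂ hmk
    refine ⟨φ₀.comp (QuotientGroup.mk' _), fun x => ?_, ⟨b, hφ₀⟩⟩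
    have hx : (QuotientGroup.mk (x ^ N) : G ⧸ (powMonoidHom N : G →* G).range) = 1 :=
      (QuotientGroup.eq_one_iff _).2 (MonoidHom.mem_range.2 ⟨x, rfl⟩)
    rw [← map_pow, MonoidHom.comp_apply, QuotientGroup.mk'_apply, hx, map_one]
  -- the finite image `A'` of `A`
  haveI : Finite (A.map ρ) := inferInstance
  have hζ' : (⟨ρ ζ, Subgroup.mem_map_of_mem ρ hζA⟩ : A.map ρ) ≠ 1 := by
    intro h
    have h' : ρ ζ = 1 := congrArg Subtype.val h
    rw [hρ1 ζ (hA ζ hζA)] at h'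
    exact lt_irrefl _ h'
  have hζ'N : (⟨ρ ζ, Subgroup.mem_map_of_mem ρ hζA⟩ : A.map ρ) ^ N = 1 := by
    apply Subtype.ext
    rw [SubmonoidClass.coe_pow, OneMemClass.coe_one, ← map_pow]
    exact (hρ1 (ζ ^ N) (hA _ (A.pow_mem hζA N))).2 hζN
  obtain ⟨φ, hφN, ⟨y, hy⟩⟩ := key (A.map ρ) _ hζ' hζ'N
  let θ : A →* ℂˣ := φ.comp (ρ.subgroupMap A)
  have hθ : ∀ x, θ x = φ (ρ.subgroupMap A x) := fun x => rfl
  refine ⟨θ, fun x => hφN _, fun x => ?_, fun x hx => ?_, ?_⟩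
  · have h1 : ‖((θ x : ℂˣ) : ℂ)‖ ^ N = 1 := by
      rw [hθ, ← norm_pow, ← Units.val_pow_eq_pow_val, hφN, Units.val_one, norm_one]
    exact (pow_eq_one_iff_of_nonneg (norm_nonneg _) hN).1 h1
  · have h1 : ρ.subgroupMap A x = 1 := Subtype.ext (by
      change ρ (x : (w.adicCompletion E)ˣ) = 1
      exact (hρ1 _ (hA _ x.2)).2 hx)
    rw [hθ, h1, map_one]
  · obtain ⟨x, rfl⟩ := MonoidHom.subgroupMap_surjective ρ A y
    exact ⟨x, hy⟩

/-- `v_w(k) ≤ 1` for a natural number `k` (non-archimedean triangle inequality). [folklore] -/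
private theorem valued_natCast_le_one (k : ℕ) : Valued.v ((k : w.adicCompletion E)) ≤ 1 := by
  induction k with
  | zero => simp
  | succ k ih =>
    rw [Nat.cast_succ]
    exact Valuation.map_add_le _ ih (by rw [Valuation.map_one])

end Local

/-! ## §2 The place model: a GLOBAL norm-one principal unit at every place; the WILD CARRIER `Ψ = θ ∘ det` at a non-split place above a
prime dividing `N` -/

section PlaceModel

variable {F : Type} (E : Type) [Field F] [NumberField F] [Field E] [NumberField E] [Algebra F E]
  [Algebra.IsQuadraticExtension F E] (v : HeightOneSpectrum (𝓞 F)) (c : E ≃ₐ[F] E)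
  {δ : E} (hcδ : c δ = -δ) (hδ : δ ≠ 0)
  (N : ℕ) (J : Matrix (Fin N) (Fin N) E) (hN : 2 ≤ N) (hJh : (J.map c)ᵀ = J) (hJdet : J.det ≠ 0)

omit [Algebra.IsQuadraticExtension F E] in
include hcδ hδ in
/-- **a GLOBAL norm-one PRINCIPAL UNIT `≠ 1` at ANY place `w ∣ v`**: `a ∈ E` with `a · c(a) = 1` and `0 < ord_w(a − 1) < ∞`, namely
`a = (1 + u)/(1 − u)` for a skew element `u = δ · π^k ≠ 0` (`c u = −u`, `π ∈ 𝔭_v`, `k` large) with `v_w(u) < 1`: `c a = (1 − u)/(1 + u)`,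
`a − 1 = 2u/(1 − u)`, `v_w(a − 1) = v_w(2) v_w(u)`. [cite: CasselsFrohlichANT1967, Ch. II §10] -/
theorem exists_mul_conj_eq_one_valuation_sub_one_lt (w : PlacesOver E v) :
    ∃ a : E, a * c a = 1 ∧ w.1.valuation E (a - 1) ≠ 0 ∧ w.1.valuation E (a - 1) < 1 := by
  classical
  -- a non-zero `π ∈ 𝔭_v`, of `w`-valuation `< 1`
  obtain ⟨π, hπv, hπ0⟩ := Submodule.exists_mem_ne_zero_of_ne_bot v.ne_bot
  haveI := PlacesOver.liesOver (E := E) w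
  set p : E := algebraMap F E (algebraMap (𝓞 F) F π) with hp
  have hp' : p = algebraMap (𝓞 E) E (algebraMap (𝓞 F) (𝓞 E) π) := by
    rw [hp, ← IsScalarTower.algebraMap_apply, ← IsScalarTower.algebraMap_apply]
  have hp1 : w.1.valuation E p < 1 := by
    rw [hp', HeightOneSpectrum.valuation_lt_one_iff_mem]
    have : π ∈ (w.1.asIdeal.under (𝓞 F)) := by
      rw [← Ideal.LiesOver.over (p := v.asIdeal) (P := w.1.asIdeal)]
      exact hπv
    exact Ideal.mem_comap.1 this
  have hp0 : p ≠ 0 := by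
    rw [hp]
    exact (map_ne_zero _).2 ((map_ne_zero_iff _ (IsFractionRing.injective (𝓞 F) F)).2 hπ0)
  have hcp : c p = p := by rw [hp, AlgEquiv.commutes]
  -- `v_w(δ) = exp m`, `v_w(p) ≤ exp(−1)`; `u = δ p^k` with `k = m.toNat + 1`
  have hvδ0 : w.1.valuation E δ ≠ 0 := (Valuation.ne_zero_iff _).2 hδ
  obtain ⟨m, hm⟩ : ∃ m : ℤ, w.1.valuation E δ = WithZero.exp m := ⟨_, (WithZero.exp_log hvδ0).symm⟩
  have hvp0 : w.1.valuation E p ≠ 0 := (Valuation.ne_zero_iff _).2 hp0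
  obtain ⟨n, hn⟩ : ∃ n : ℤ, w.1.valuation E p = WithZero.exp n := ⟨_, (WithZero.exp_log hvp0).symm⟩
  have hn0 : n < 0 := by
    rw [hn, ← WithZero.exp_zero, WithZero.exp_lt_exp] at hp1
    exact hp1
  set k : ℕ := m.toNat + 1 with hk
  set u : E := δ * p ^ k with hu
  have hcu : c u = -u := by rw [hu, map_mul, map_pow, hcδ, hcp, neg_mul]
  have hu0 : u ≠ 0 := mul_ne_zero hδ (pow_ne_zero _ hp0)
  have hu1 : w.1.valuation E u < 1 := by
    rw [hu, map_mul, map_pow, hm, hn, ← WithZero.exp_nsmul, ← WithZero.exp_add, ← WithZero.exp_zero, WithZero.exp_lt_exp,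
      nsmul_eq_mul]
    have hk1 : (k : ℤ) = m.toNat + 1 := by rw [hk]; push_cast; ring
    have : (k : ℤ) * n ≤ -(k : ℤ) := by nlinarith
    omega
  -- `a = (1 + u)/(1 − u)`
  have h1u : w.1.valuation E (1 - u) = 1 := Valuation.map_one_sub_of_lt _ hu1
  have h1u' : w.1.valuation E (1 + u) = 1 := Valuation.map_one_add_of_lt _ hu1
  have hne1 : (1 - u : E) ≠ 0 := fun h => by rw [h, map_zero] at h1u; exact zero_ne_one h1u
  have hne1' : (1 + u : E) ≠ 0 := fun h => by rw [h, map_zero] at h1u'; exact zero_ne_one h1u'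
  refine ⟨(1 + u) * (1 - u)⁻¹, ?_, ?_, ?_⟩
  · rw [map_mul, map_inv₀, map_add, map_sub, map_one, hcu, sub_neg_eq_add, ← sub_eq_add_neg]
    field_simp
  · have hrw : (1 + u) * (1 - u)⁻¹ - 1 = (2 * u) * (1 - u)⁻¹ := by field_simp; ring
    rw [hrw, map_mul, map_inv₀, h1u, inv_one, mul_one, map_mul]
    refine mul_ne_zero ((Valuation.ne_zero_iff _).2 two_ne_zero) ((Valuation.ne_zero_iff _).2 hu0)
  · have hrw : (1 + u) * (1 - u)⁻¹ - 1 = (2 * u) * (1 - u)⁻¹ := by field_simp; ring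
    rw [hrw, map_mul, map_inv₀, h1u, inv_one, mul_one, map_mul]
    have h2 : w.1.valuation E 2 ≤ 1 := by
      rw [show (2 : E) = 1 + 1 by norm_num]
      exact Valuation.map_add_le _ (by rw [Valuation.map_one]) (by rw [Valuation.map_one])
    exact mul_lt_of_le_one_of_lt h2 hu1

include hcδ hδ in
/-- at a NON-SPLIT place `w` (`c • w = w`), norm-one elements are `w`-units (`v_w(z_w)² = 1`). [cite: CasselsFrohlichANT1967, Ch. VII §1.1] -/
private theorem valued_apply_eq_one_of_mem_normOne (w : PlacesOver E v) (hw : c • w.1 = w.1)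
    (z : (LemD1OfPlace.standingData E v c N J hcδ hδ hN hJh hJdet).normOne) :
    Valued.v ((((z : (LocalRing E v)ˣ) : LocalRing E v)) w) = 1 := by
  have h := LemD1IndexedNonVacuityInertRigidity.valued_mul_conjLocal_apply E v c hcδ hδ w hw ((z : (LocalRing E v)ˣ) : LocalRing E v)
  rw [LemD1OfPlace.mul_conjLocal_eq_one E v c N J hcδ hδ hN hJh hJdet z, Pi.one_apply, map_one] at h
  exact (pow_eq_one_iff_left two_ne_zero).1 h.symm

/-- determinants of `U(V)(F_v)` are norm-one: `det g · (c ⊗ 1)(det g) = 1`. [cite: Liu2021, App. D §D.1 (l. 5213)] [cite: Mok2014, §1 Notation p. 5] -/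
private theorem det_mem_normOne (g : (LemD1OfPlace.standingData E v c N J hcδ hδ hN hJh hJdet).U) :
    Matrix.GeneralLinearGroup.det (g : GL (Fin N) (LocalRing E v)) ∈ (LemD1OfPlace.standingData E v c N J hcδ hδ hN hJh hJdet).normOne := by
  let S := LemD1OfPlace.standingData E v c N J hcδ hδ hN hJh hJdet
  rw [OscillatorStandingData.mem_normOne_iff', Matrix.GeneralLinearGroup.val_det_apply]
  have hg := (OscillatorStandingData.mem_U_iff S _).1 g.2
  have h := congrArg Matrix.det hg
  rw [Matrix.det_mul, Matrix.det_mul, Matrix.det_transpose] at h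
  have hc : (((g : GL (Fin N) (LocalRing E v)) : Matrix (Fin N) (Fin N) (LocalRing E v)).map S.conj).det =
      S.conj (((g : GL (Fin N) (LocalRing E v)) : Matrix (Fin N) (Fin N) (LocalRing E v)).det) := by
    rw [AlgEquiv.map_det, AlgEquiv.mapMatrix_apply]
  rw [hc] at h
  have h2 : (((g : GL (Fin N) (LocalRing E v)) : Matrix (Fin N) (Fin N) (LocalRing E v)).det *
      S.conj (((g : GL (Fin N) (LocalRing E v)) : Matrix (Fin N) (Fin N) (LocalRing E v)).det) - 1) * S.gram.det = 0 := by
    linear_combination h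
  exact sub_eq_zero.1 ((S.isUnit_det_gram.mul_left_eq_zero).1 h2)

include hcδ in
/-- **the WILD CARRIER character at a NON-SPLIT place ABOVE A PRIME DIVIDING `N`** (`c • w = w`, `v_w(N) < 1`; ANY quadratic `E/F`, no
torsion hypothesis): with the global norm-one principal unit `a` of `exists_mul_conj_eq_one_valuation_sub_one_lt` (`γ = v_w(a − 1)`,
`0 < ord_w(a − 1)`), §1 gives `v_w(a^N − 1) < γ` (`valued_pow_sub_one_lt`) and hence a character `θ` of the image of `E_v¹` in `E_wˣ` with
`θ^N = 1`, `θ = 1` on `{v_w(x − 1) < γ}`, `θ ≠ 1`; then `Ψ = θ ∘ det` satisfies `Ψ ∘ S.scalar = 1` (`det(z · 1_N) = z^N`), `Ψ = 1` on the open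
neighbourhood `{g : v_w(det(g)_w − 1) < γ}` of `1`, `Ψ(g₀) ≠ 1` for some `g₀` (`det` is onto `E_v¹`, `…DetCarrier.exists_mem_U_det_eq`), all
values `N`-th roots of unity.  [cite: Liu2021, App. D §D.1 Step 3 (l. 5221)] [cite: Mok2014, §1 Notation p. 5]
[cite: NeukirchANT1999, Ch. II §3 Prop. (3.10)] -/
theorem exists_wild_carrier_character (w : PlacesOver E v) (hw : c • w.1 = w.1)
    (hwN : Valued.v ((N : w.1.adicCompletion E)) < 1) :
    ∃ Ψ : (LemD1OfPlace.standingData E v c N J hcδ hδ hN hJh hJdet).U →* ℂˣ,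
      (∀ z : (LemD1OfPlace.standingData E v c N J hcδ hδ hN hJh hJdet).normOne,
        Ψ ((LemD1OfPlace.standingData E v c N J hcδ hδ hN hJh hJdet).scalar z) = 1) ∧
      (∃ O : Set (LemD1OfPlace.standingData E v c N J hcδ hδ hN hJh hJdet).U, IsOpen O ∧ 1 ∈ O ∧ ∀ g ∈ O, Ψ g = 1) ∧
      (∃ g₀ : (LemD1OfPlace.standingData E v c N J hcδ hδ hN hJh hJdet).U, Ψ g₀ ≠ 1) ∧
      (∀ g, Ψ g ^ N = 1) ∧ (∀ g, ‖((Ψ g : ℂˣ) : ℂ)‖ = 1) := by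
  have hN0 : N ≠ 0 := by omega
  let S := LemD1OfPlace.standingData E v c N J hcδ hδ hN hJh hJdet
  let prw : (LocalRing E v)ˣ →* (w.1.adicCompletion E)ˣ :=
    Units.map (Pi.evalRingHom (fun w' : PlacesOver E v => w'.1.adicCompletion E) w).toMonoidHom
  have hprw : ∀ y : (LocalRing E v)ˣ, ((prw y : (w.1.adicCompletion E)ˣ) : w.1.adicCompletion E) = (y : LocalRing E v) w :=
    fun y => rfl
  -- the image `A` of `E_v¹` in `E_wˣ`: `w`-units
  let A : Subgroup (w.1.adicCompletion E)ˣ := S.normOne.map prw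
  have hA : ∀ x ∈ A, Valued.v ((x : (w.1.adicCompletion E)ˣ) : w.1.adicCompletion E) = 1 := by
    rintro x ⟨z, hz, rfl⟩
    rw [hprw]
    exact valued_apply_eq_one_of_mem_normOne E v c hcδ hδ N J hN hJh hJdet w hw ⟨z, hz⟩
  -- the global principal norm-one unit `ι(a) ∈ E_v¹`
  obtain ⟨a, hac, ha0, ha1⟩ := exists_mul_conj_eq_one_valuation_sub_one_lt E v c hcδ hδ w
  have hu : IsUnit (algebraMap E (LocalRing E v) a) :=
    IsUnit.of_mul_eq_one (algebraMap E (LocalRing E v) (c a)) (by rw [← map_mul, hac, map_one])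
  have hzn : hu.unit ∈ S.normOne := by
    rw [OscillatorStandingData.mem_normOne_iff', LemD1OfPlace.standingData_conj_apply, IsUnit.unit_spec, conjLocal_algebraMap,
      ← map_mul, hac, map_one]
  have hζA : prw hu.unit ∈ A := Subgroup.mem_map_of_mem prw hzn
  have hcoe : ((prw hu.unit : (w.1.adicCompletion E)ˣ) : w.1.adicCompletion E) = ((a : E) : w.1.adicCompletion E) := by
    rw [hprw, IsUnit.unit_spec]; rfl
  have hval : Valued.v (((prw hu.unit : (w.1.adicCompletion E)ˣ) : w.1.adicCompletion E) - 1) = w.1.valuation E (a - 1) := by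
    rw [hcoe]
    have : ((a : E) : w.1.adicCompletion E) - 1 = ((a - 1 : E) : w.1.adicCompletion E) := by
      change algebraMap E (w.1.adicCompletion E) a - 1 = algebraMap E (w.1.adicCompletion E) (a - 1)
      rw [map_sub, map_one]
    rw [this, HeightOneSpectrum.valuedAdicCompletion_eq_valuation']
  have hζ0 : Valued.v (((prw hu.unit : (w.1.adicCompletion E)ˣ) : w.1.adicCompletion E) - 1) ≠ 0 := by rw [hval]; exact ha0
  have hζ1 : Valued.v (((prw hu.unit : (w.1.adicCompletion E)ˣ) : w.1.adicCompletion E) - 1) < 1 := by rw [hval]; exact ha1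
  have hζN : Valued.v ((((prw hu.unit) ^ N : (w.1.adicCompletion E)ˣ) : w.1.adicCompletion E) - 1) <
      Valued.v (((prw hu.unit : (w.1.adicCompletion E)ˣ) : w.1.adicCompletion E) - 1) := by
    rw [Units.val_pow_eq_pow_val]
    exact valued_pow_sub_one_lt w.1 hwN hζ0 hζ1
  obtain ⟨θ, hθN, hθnorm, hθ1, ⟨x₀, hx₀⟩⟩ := exists_character_pow_eq_one_of_level w.1 hN0 A hA hζA hζ0 hζN
  -- `θ' = θ ∘ (E_v¹ → A)`, `detN : U(V)(F_v) → E_v¹`, `Ψ = θ' ∘ detN`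
  let θ' : S.normOne →* ℂˣ := θ.comp (prw.subgroupMap S.normOne)
  have hθ' : ∀ z, θ' z = θ (prw.subgroupMap S.normOne z) := fun z => rfl
  let detN : S.U →* S.normOne :=
    (Matrix.GeneralLinearGroup.det.comp S.U.subtype).codRestrict S.normOne fun g => det_mem_normOne E v c hcδ hδ N J hN hJh hJdet g
  have hdetN : ∀ g : S.U, ((detN g : S.normOne) : (LocalRing E v)ˣ) = Matrix.GeneralLinearGroup.det (g : GL (Fin N) (LocalRing E v)) :=
    fun g => rfl
  let Ψ : S.U →* ℂˣ := θ'.comp detN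
  have hΨ : ∀ g, Ψ g = θ' (detN g) := fun g => rfl
  have hdet : ∀ z : S.normOne, detN (S.scalar z) = z ^ N := fun z => by
    apply Subtype.ext
    rw [hdetN, SubgroupClass.coe_pow]
    apply Units.ext
    rw [Matrix.GeneralLinearGroup.val_det_apply, OscillatorStandingData.coe_scalar, Matrix.scalar_apply, Matrix.det_diagonal,
      Finset.prod_const, Finset.card_univ, Fintype.card_fin, Units.val_pow_eq_pow_val]
  refine ⟨Ψ, fun z => ?_, ?_, ?_, fun g => by rw [hΨ, hθ', hθN], fun g => by rw [hΨ, hθ', hθnorm]⟩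
  · rw [hΨ, hdet, map_pow, hθ', hθN]
  · let f : S.U → w.1.adicCompletion E := fun g =>
      (((g : GL (Fin N) (LocalRing E v)) : Matrix (Fin N) (Fin N) (LocalRing E v)).map
        (Pi.evalRingHom (fun w' : PlacesOver E v => w'.1.adicCompletion E) w)).det
    have hf : ∀ g, f g = ((prw (Matrix.GeneralLinearGroup.det (g : GL (Fin N) (LocalRing E v))) :
        (w.1.adicCompletion E)ˣ) : w.1.adicCompletion E) := fun g => by
      rw [hprw, Matrix.GeneralLinearGroup.val_det_apply]
      change _ = (Pi.evalRingHom (fun w' : PlacesOver E v => w'.1.adicCompletion E) w)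
        (((g : GL (Fin N) (LocalRing E v)) : Matrix (Fin N) (Fin N) (LocalRing E v)).det)
      rw [RingHom.map_det]
      rfl
    have hfc : Continuous f := by
      refine Continuous.matrix_det ?_
      refine Continuous.matrix_map ?_ (continuous_apply w)
      exact Units.continuous_val.comp continuous_subtype_val
    refine ⟨f ⁻¹' {y | Valued.v (y - 1) < Valued.v (((prw hu.unit : (w.1.adicCompletion E)ˣ) : w.1.adicCompletion E) - 1)},
      (isOpen_setOf_valued_sub_one_lt w.1 _).preimage hfc, ?_, fun g hg => ?_⟩
    · rw [Set.mem_preimage, Set.mem_setOf_eq, hf, OneMemClass.coe_one, map_one, map_one, Units.val_one, sub_self, map_zero]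
      exact zero_lt_iff.2 hζ0
    · rw [Set.mem_preimage, Set.mem_setOf_eq, hf] at hg
      rw [hΨ, hθ']
      exact hθ1 _ hg
  · obtain ⟨z₀, rfl⟩ := MonoidHom.subgroupMap_surjective prw S.normOne x₀
    obtain ⟨g₀, hg₀⟩ := LemD1IndexedNonVacuityDetCarrier.exists_mem_U_det_eq E v c hcδ hδ N J hN hJh hJdet z₀
    refine ⟨g₀, ?_⟩
    have hdg : detN g₀ = z₀ := Subtype.ext (by rw [hdetN, hg₀])
    rw [hΨ, hdg, hθ']
    exact hx₀

/-! ## §3 The JOINT certificate «(1) ∧ (3)» with the `μ`-conjunct ALONE separating — every place `w ∣ v` with `v_w(N) < 1` -/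

/-- For a datum whose carrier is the line `ℂ` with `U(V)(F)` acting through a character `λ` that agrees with `χ` on the centre,
the `χ`-augmentation submodule vanishes (copy of the siblings' private lemma). [folklore] -/
private theorem augmentation_eq_bot_of_character {F₀ E₀ : Type} [Field F₀] [ValuativeRel F₀] [TopologicalSpace F₀]
    [CommRing E₀] [Algebra F₀ E₀] [TopologicalSpace E₀] {n : ℕ} (L : LemD1Data F₀ E₀ n ℂ) (lam : L.S.U →* ℂˣ)
    (hω : ∀ (g : L.S.U) (x : ℂ), L.omega g x = (lam g : ℂ) * x)
    (hcen : ∀ z : L.S.normOne, lam (L.S.scalar z) = L.chi z) :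
    augmentation L.omega L.S.scalar L.chi = ⊥ := by
  unfold augmentation
  refine iSup_eq_bot.2 fun z => ?_
  rw [LinearMap.range_eq_bot]
  ext
  simp [hω, hcen]

/-- Two lines on which a group acts through characters `λ₁` and `λ₀` with `λ₁ g₀ ≠ λ₀ g₀` for some `g₀` have NON-isomorphic maximal
`χ`-quotients (the first quotient being the line itself).  Copy of the siblings' private lemma. [folklore] -/
private theorem not_areIsomorphicRep_quotRep_of_characters {G Z : Type*} [Group G] [Group Z]
    (ρ₁ ρ₀ : Representation ℂ G ℂ) {ζ : Z →* G} (hζ : ∀ z, ζ z ∈ Subgroup.center G) (χ₁ χ₀ : Z →* ℂˣ)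
    (lam₁ lam₀ : G →* ℂˣ) (h₁ : ∀ (g : G) (x : ℂ), ρ₁ g x = (lam₁ g : ℂ) * x) (h₀ : ∀ (g : G) (x : ℂ), ρ₀ g x = (lam₀ g : ℂ) * x)
    (hN₁ : augmentation ρ₁ ζ χ₁ = ⊥) {g₀ : G} (hg₀ : lam₁ g₀ ≠ lam₀ g₀) :
    ¬ AreIsomorphicRep (quotRep ρ₁ hζ χ₁) (quotRep ρ₀ hζ χ₀) := by
  rintro ⟨f, hf⟩
  have hw0 : (Submodule.Quotient.mk 1 : ℂ ⧸ augmentation ρ₁ ζ χ₁) ≠ 0 := by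
    rw [Ne, Submodule.Quotient.mk_eq_zero, hN₁, Submodule.mem_bot]
    exact one_ne_zero
  have h1 : quotRep ρ₁ hζ χ₁ g₀ (Submodule.Quotient.mk 1) =
      (lam₁ g₀ : ℂ) • (Submodule.Quotient.mk 1 : ℂ ⧸ augmentation ρ₁ ζ χ₁) := by
    rw [quotRep_mk, h₁, ← smul_eq_mul, Submodule.Quotient.mk_smul]
  have h2 : ∀ y : ℂ ⧸ augmentation ρ₀ ζ χ₀, quotRep ρ₀ hζ χ₀ g₀ y = (lam₀ g₀ : ℂ) • y := by
    intro y
    obtain ⟨u, rfl⟩ := Submodule.Quotient.mk_surjective _ y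
    rw [quotRep_mk, h₀, ← smul_eq_mul, Submodule.Quotient.mk_smul]
  have key := hf g₀ (Submodule.Quotient.mk 1)
  rw [h1, h2, map_smul] at key
  have hsub : ((lam₁ g₀ : ℂ) - lam₀ g₀) • f (Submodule.Quotient.mk 1) = 0 := by
    rw [sub_smul, key, sub_self]
  rcases smul_eq_zero.1 hsub with h | h
  · exact hg₀ (Units.ext (sub_eq_zero.1 h))
  · exact hw0 (f.injective (by rw [h, map_zero]))

/-- **Item (1) AS PRINTED holds at a character datum of rank `n ≠ 2`** (copy of the siblings' private lemma).
[cite: Liu2021, App. D Lemma D.1 (1) (l. 5229)] -/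
private theorem lemD1_1AsPrinted_of_character_of_rank_ne_two' {F₀ E₀ : Type} [Field F₀] [ValuativeRel F₀]
    [TopologicalSpace F₀] [CommRing E₀] [Algebra F₀ E₀] [TopologicalSpace E₀] [IsTopologicalRing E₀] {n₀ : ℕ}
    (L : LemD1Data F₀ E₀ n₀ ℂ) (lam : L.S.U →* ℂˣ) (hω : ∀ (g : L.S.U) (x : ℂ), L.omega g x = (lam g : ℂ) * x)
    (hcen : ∀ z : L.S.normOne, lam (L.S.scalar z) = L.chi z)
    (hopen : ∃ O : Set L.S.U, IsOpen O ∧ (1 : L.S.U) ∈ O ∧ ∀ g ∈ O, lam g = 1) (hn : n₀ ≠ 2) :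
    LemD1_1AsPrinted L := by
  have hN : augmentation L.omega L.S.scalar L.chi = ⊥ := augmentation_eq_bot_of_character L lam hω hcen
  have hfin : Module.finrank ℂ (ℂ ⧸ augmentation L.omega L.S.scalar L.chi) = 1 := by
    rw [(Submodule.quotEquivOfEqBot _ hN).finrank_eq, Module.finrank_self]
  haveI hsimple : IsSimpleModule ℂ (ℂ ⧸ augmentation L.omega L.S.scalar L.chi) :=
    isSimpleModule_iff_finrank_eq_one.2 hfin
  have hact : ∀ (g : L.S.U) (w : ℂ ⧸ augmentation L.omega L.S.scalar L.chi),
      L.datum.quot g w = (lam g : ℂ) • w := by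
    intro g w
    obtain ⟨y, rfl⟩ := Submodule.Quotient.mk_surjective _ w
    rw [LemD1Data.datum_quot, quotRep_mk, hω, ← smul_eq_mul, Submodule.Quotient.mk_smul]
  refine ⟨⟨?_, ?_, ?_⟩, ?_⟩
  · intro W
    rcases eq_bot_or_eq_top W.toSubmodule with h | h
    · exact Or.inl (Subrepresentation.toSubmodule_injective h)
    · exact Or.inr (Subrepresentation.toSubmodule_injective h)
  · intro x
    obtain ⟨O, hO, h1O, hlam⟩ := hopen
    change IsOpen (L.datum.quot.stabilizerSubgroup x : Set L.S.U)
    refine Subgroup.isOpen_of_mem_nhds _ (g := 1) (Filter.mem_of_superset (hO.mem_nhds h1O) fun g hg => ?_)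
    change L.datum.quot g x = x
    rw [hact, hlam g hg, Units.val_one, one_smul]
  · intro K _
    infer_instance
  · refine iff_of_false ?_ ?_
    · rw [not_subsingleton_iff_nontrivial]
      exact Module.nontrivial_of_finrank_pos (R := ℂ) (by rw [hfin]; exact one_pos)
    · exact fun h => hn h.2.1.2

include hcδ in
/-- **the `μ`-alone family from ANY character of `U(V)(F_v)` trivial on the centre, with open kernel neighbourhood and a non-trivial value**:
labels `(μ, e, 1)`, `(μ', e, 1)` (`μ'` the level twist, `μ'(ε) = −μ(ε)`), carriers the trivial line and the line of `Ψ`; (1) member by member,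
(3) for all four pairs, only the `μ`-conjunct failing, the `ω`'s non-isomorphic. [cite: Liu2021, App. D Lemma D.1 (1) and (3) (l. 5229, 5233)] -/
private theorem exists_family_of_central_trivial_character (w : PlacesOver E v) (h3 : 3 ≤ N)
    (μ : LemD1.MuSet (LemD1OfPlace.standingData E v c N J hcδ hδ hN hJh hJdet))
    (e : LemD1.EpsRep (LemD1OfPlace.standingData E v c N J hcδ hδ hN hJh hJdet))
    (Ψ : (LemD1OfPlace.standingData E v c N J hcδ hδ hN hJh hJdet).U →* ℂˣ)
    (hcen : ∀ z : (LemD1OfPlace.standingData E v c N J hcδ hδ hN hJh hJdet).normOne,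
      Ψ ((LemD1OfPlace.standingData E v c N J hcδ hδ hN hJh hJdet).scalar z) = 1)
    (hopen : ∃ O : Set (LemD1OfPlace.standingData E v c N J hcδ hδ hN hJh hJdet).U, IsOpen O ∧ 1 ∈ O ∧ ∀ g ∈ O, Ψ g = 1)
    (hne : ∃ g₀ : (LemD1OfPlace.standingData E v c N J hcδ hδ hN hJh hJdet).U, Ψ g₀ ≠ 1) :
    ∃ Lf : LemD1IndexedFamily (v.adicCompletion F) (LocalRing E v) N (Fin 2),
      Lf.S = LemD1OfPlace.standingData E v c N J hcδ hδ hN hJh hJdet ∧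
      (∀ i, (Lf.eps i).1 = e.1) ∧ (∀ i, (Lf.chi i).1 = 1) ∧ (Lf.mu 0).1 = μ.1 ∧
      (Lf.mu 1).1 (LemD1OfPlace.eps E v hδ) = -μ.1 (LemD1OfPlace.eps E v hδ) ∧
      Lf.Item1AsPrinted ∧ LemD1_3AsPrintedI Lf ∧
      Lf.mu 0 ≠ Lf.mu 1 ∧ LemD1.SameClass (Lf.eps 0) (Lf.eps 1) ∧ Lf.chi 0 = Lf.chi 1 ∧
      ¬ AreIsomorphicRep (Lf.quot 1) (Lf.quot 0) := by
  classical
  obtain ⟨e₁, he₁⟩ := e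
  have hN2 : N ≠ 2 := by omega
  obtain ⟨μ₁, hneμ, hμ₁, -⟩ := LemD1IndexedNonVacuityLevelTwist.exists_muSet_ne_twist E v c hcδ hδ N J hN hJh hJdet w μ
  obtain ⟨g₀, hΨg₀⟩ := hne
  let S := LemD1OfPlace.standingData E v c N J hcδ hδ hN hJh hJdet
  let χ₀ : LemD1.ChiSet S := ⟨1, fun z => by simp, by simpa using continuous_const⟩
  let ω₀ : Representation ℂ S.U ℂ := Representation.trivial ℂ S.U ℂ
  let ω₁ : Representation ℂ S.U ℂ := (DistribMulAction.toModuleEnd ℂ ℂ).comp Ψ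
  have hω₀ : ∀ (g : S.U) (x : ℂ), ω₀ g x = ((1 : S.U →* ℂˣ) g : ℂ) * x := fun g x => by
    rw [MonoidHom.one_apply, Units.val_one, one_mul]; rfl
  have hω₁ : ∀ (g : S.U) (x : ℂ), ω₁ g x = (Ψ g : ℂ) * x := fun g x => by
    change (Ψ g : ℂˣ) • x = _
    rw [Units.smul_def, smul_eq_mul]
  have hcen' : ∀ z : S.normOne, Ψ (S.scalar z) = χ₀.1 z := fun z => by
    rw [hcen z]; rfl
  let Lf : LemD1IndexedFamily (v.adicCompletion F) (LocalRing E v) N (Fin 2) :=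
    { isNonarchimedeanLocalField := inferInstance
      isModuleTopology := LemD1OfPlace.isModuleTopology_localRing E v
      S := S
      mu := ![μ, μ₁]
      eps := fun _ => ⟨e₁, he₁⟩
      chi := fun _ => χ₀
      V := fun _ => ℂ
      omega := ![ω₀, ω₁] }
  have hμne : Lf.mu 0 ≠ Lf.mu 1 := fun h => hneμ h.symm
  have hN₁ : augmentation (Lf.single 1).omega (Lf.single 1).S.scalar (Lf.single 1).chi = ⊥ :=
    augmentation_eq_bot_of_character (Lf.single 1) Ψ hω₁ hcen'
  have hg₀ : Ψ g₀ ≠ (1 : S.U →* ℂˣ) g₀ := by rwa [MonoidHom.one_apply]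
  have hnotiso : ¬ AreIsomorphicRep (Lf.quot 1) (Lf.quot 0) :=
    not_areIsomorphicRep_quotRep_of_characters ω₁ ω₀ S.scalar_mem_center χ₀.1 χ₀.1 Ψ 1 hω₁ hω₀ hN₁ hg₀
  have hItem1 : Lf.Item1AsPrinted := by
    intro i
    fin_cases i
    · exact lemD1_1AsPrinted_of_character_of_rank_ne_two' (Lf.single 0) 1 hω₀ (fun z => rfl)
        ⟨Set.univ, isOpen_univ, Set.mem_univ _, fun g _ => rfl⟩ hN2
    · exact lemD1_1AsPrinted_of_character_of_rank_ne_two' (Lf.single 1) Ψ hω₁ hcen' hopen hN2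
  have hrefl : ∀ k : Fin 2, (AreIsomorphicRep (Lf.quot k) (Lf.quot k) ↔
      (Lf.mu k = Lf.mu k ∧ LemD1.SameClass (Lf.eps k) (Lf.eps k) ∧ Lf.chi k = Lf.chi k)) :=
    fun k => iff_of_true ⟨LinearEquiv.refl ℂ _, fun _ _ => rfl⟩ ⟨rfl, ⟨1, by simp⟩, rfl⟩
  have hItem3 : LemD1_3AsPrintedI Lf := by
    intro _ i j
    fin_cases i <;> fin_cases j
    · exact hrefl 0
    · exact iff_of_false hnotiso fun h => hμne h.1.symm
    · exact iff_of_false (fun h => hnotiso h.symm) fun h => hμne h.1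
    · exact hrefl 1
  have hsame : LemD1.SameClass (Lf.eps 0) (Lf.eps 1) := hrefl 0 |>.mp ⟨LinearEquiv.refl ℂ _, fun _ _ => rfl⟩ |>.2.1
  exact ⟨Lf, rfl, fun _ => rfl, fun _ => rfl, rfl, hμ₁, hItem1, hItem3, hμne, hsame, rfl, hnotiso⟩

include hcδ in
/-- **(1) ∧ (3) JOINTLY with the `μ`-CONJUNCT ALONE SEPARATING — at EVERY place `w ∣ v` ABOVE A PRIME DIVIDING `N` (`v_w(N) < 1`), every
`N ≥ 3`, ANY quadratic `E/F`**: for every `μ ∈ MuSet S` and every representative `e`, the two-member collection with labels `(μ, e, 1)`,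
`(μ', e, 1)` (`μ'` the level twist, the SAME `ε`, the SAME `χ = 1`) and carriers the trivial line and the line of a centre-trivial character `Ψ`
of `U(V)(F_v)` — the det carrier of `…DetCarrier` if `w` is SPLIT, the wild carrier of §2 if `w` is NON-SPLIT — satisfies [Lem. D.1, first
sentence + (1)] AS PRINTED member by member AND [Lem. D.1 (3)] AS PRINTED for all four pairs; exactly the `μ`-conjunct fails and the `ω`'s are
non-isomorphic with EQUAL central characters. [cite: Liu2021, App. D Lemma D.1 (1) and (3) (l. 5229, 5233)] -/
theorem exists_lemD1IndexedFamily_item1_and_lemD1_3_mu_of_wild (w : PlacesOver E v)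
    (hwN : Valued.v ((N : w.1.adicCompletion E)) < 1) (h3 : 3 ≤ N)
    (μ : LemD1.MuSet (LemD1OfPlace.standingData E v c N J hcδ hδ hN hJh hJdet))
    (e : LemD1.EpsRep (LemD1OfPlace.standingData E v c N J hcδ hδ hN hJh hJdet)) :
    ∃ Lf : LemD1IndexedFamily (v.adicCompletion F) (LocalRing E v) N (Fin 2),
      Lf.S = LemD1OfPlace.standingData E v c N J hcδ hδ hN hJh hJdet ∧
      (∀ i, (Lf.eps i).1 = e.1) ∧ (∀ i, (Lf.chi i).1 = 1) ∧ (Lf.mu 0).1 = μ.1 ∧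
      (Lf.mu 1).1 (LemD1OfPlace.eps E v hδ) = -μ.1 (LemD1OfPlace.eps E v hδ) ∧
      Lf.Item1AsPrinted ∧ LemD1_3AsPrintedI Lf ∧
      Lf.mu 0 ≠ Lf.mu 1 ∧ LemD1.SameClass (Lf.eps 0) (Lf.eps 1) ∧ Lf.chi 0 = Lf.chi 1 ∧
      ¬ AreIsomorphicRep (Lf.quot 1) (Lf.quot 0) := by
  by_cases hw : c • w.1 = w.1
  · obtain ⟨Ψ, hcen, hopen, hne, -, -⟩ :=
      exists_wild_carrier_character E v c hcδ hδ N J hN hJh hJdet w hw hwN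
    exact exists_family_of_central_trivial_character E v c hcδ hδ N J hN hJh hJdet w h3 μ e Ψ hcen hopen hne
  · exact LemD1IndexedNonVacuityDetCarrier.exists_lemD1IndexedFamily_item1_and_lemD1_3_mu_of_split E v c hcδ hδ N J hN hJh hJdet
      w hw h3 μ e

include hcδ in
/-- **Consequence — every place `w ∣ v` above a prime dividing `N`, every `N ≥ 3`, ANY quadratic `E/F`, NO hypothesis on `μ`** (the Step-2
index set is non-empty at every place, `…NormClassExtensionDyadic.nonempty_muSet`): the records (1) ∧ (3) read on an indexed collection over
the place model do NOT by their shape force «same `ε`-class ∧ same `χ` ⟹ same `μ`». [cite: Liu2021, App. D Lemma D.1 (1) and (3) (l. 5229, 5233)] -/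
theorem not_forall_mu_eq_of_sameClass_of_chi_eq_of_wild (w : PlacesOver E v)
    (hwN : Valued.v ((N : w.1.adicCompletion E)) < 1) (h3 : 3 ≤ N) :
    ¬ ∀ Lf : LemD1IndexedFamily (v.adicCompletion F) (LocalRing E v) N (Fin 2),
        Lf.S = LemD1OfPlace.standingData E v c N J hcδ hδ hN hJh hJdet →
        Lf.Item1AsPrinted → LemD1_3AsPrintedI Lf →
        ∀ i j : Fin 2, LemD1.SameClass (Lf.eps i) (Lf.eps j) → Lf.chi i = Lf.chi j → Lf.mu i = Lf.mu j := by
  obtain ⟨μ⟩ := LemD1IndexedNonVacuityNormClassExtensionDyadic.nonempty_muSet E v c hcδ hδ N J hN hJh hJdet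
  intro h
  obtain ⟨Lf, hS, -, -, -, -, h1, h3', hne, hsame, hchi, -⟩ :=
    exists_lemD1IndexedFamily_item1_and_lemD1_3_mu_of_wild E v c hcδ hδ N J hN hJh hJdet w hwN h3 μ
      (LemD1OfPlace.epsDelta E v c N J hcδ hδ hN hJh hJdet)
  exact hne (h Lf hS h1 h3' 0 1 hsame hchi)

include hcδ in
/-- **… nor «same Step-3 character `χ` ⟹ isomorphic `ω`'s»** — every place `w ∣ v` above a prime dividing `N`, every `N ≥ 3`.
[cite: Liu2021, App. D Lemma D.1 (1) and (3) (l. 5229, 5233)] -/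
theorem not_forall_areIsomorphicRep_of_chi_eq_of_wild (w : PlacesOver E v)
    (hwN : Valued.v ((N : w.1.adicCompletion E)) < 1) (h3 : 3 ≤ N) :
    ¬ ∀ Lf : LemD1IndexedFamily (v.adicCompletion F) (LocalRing E v) N (Fin 2),
        Lf.S = LemD1OfPlace.standingData E v c N J hcδ hδ hN hJh hJdet →
        Lf.Item1AsPrinted → LemD1_3AsPrintedI Lf →
        ∀ i j : Fin 2, Lf.chi i = Lf.chi j → AreIsomorphicRep (Lf.quot j) (Lf.quot i) := by
  obtain ⟨μ⟩ := LemD1IndexedNonVacuityNormClassExtensionDyadic.nonempty_muSet E v c hcδ hδ N J hN hJh hJdet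
  intro h
  obtain ⟨Lf, hS, -, -, -, -, h1, h3', -, -, hchi, hnot⟩ :=
    exists_lemD1IndexedFamily_item1_and_lemD1_3_mu_of_wild E v c hcδ hδ N J hN hJh hJdet w hwN h3 μ
      (LemD1OfPlace.epsDelta E v c N J hcδ hδ hN hJh hJdet)
  exact hnot (h Lf hS h1 h3' 0 1 hchi)

end PlaceModel

/-! ## §4 The CM rows at the places of `L` above a prime dividing `N` (for the END: above `3`) -/

section CM

open Literature.NumberTheory.GelbartRogawski1991.UnitaryDualPair (imagUnit complexConj_imagUnit imagUnit_ne_zero)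
open Literature.NumberTheory.GelbartRogawski1991.UnitaryDualPair.LocalSplitting (localMu norm_localMu continuous_localMu
  localMu_toLocalRing_eq_one_iff)
open Literature.NumberTheory.Automorphic.IdeleClassGroup (toHeckeCharacter isUnitary_toHeckeCharacter IsConjugateSymplectic)
open Literature.RepresentationTheory.Liu2021 (isOscillatorChar_toHeckeCharacter_iff)

variable (L : Type) [Field L] [NumberField L] [IsCMField L]

local notation3 "cc" => (IsCMField.complexConj L)
local notation3 "L⁺" => (↥(maximalRealSubfield L))

variable (v : HeightOneSpectrum (𝓞 (maximalRealSubfield L))) (N : ℕ) (J : Matrix (Fin N) (Fin N) L) (hN : 2 ≤ N)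
  (hJh : (J.map (IsCMField.complexConj L))ᵀ = J) (hJdet : J.det ≠ 0)

/-- **the `μ`-alone certificate with the rows' OWN `μ_v` as member `0` — at every place `w ∣ v` of `L` with `v_w(N) < 1`** (ANY CM field,
no root of unity needed), every `N ≥ 3`, every conjugate symplectic `ψ`.
[cite: Liu2021, App. D Lemma D.1 (1) and (3) (l. 5229, 5233); Def. 4.11 (l. 2086)] -/
theorem exists_lemD1IndexedFamily_item1_and_lemD1_3_localMu_mu_of_wild (w : PlacesOver L v)
    (hwN : Valued.v ((N : w.1.adicCompletion L)) < 1) (h3 : 3 ≤ N)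
    (ψ : IdeleClassGroup L →ₜ* Circle) (hψ : IsConjugateSymplectic L ψ) :
    ∃ Lf : LemD1IndexedFamily (v.adicCompletion L⁺) (LocalRing L v) N (Fin 2),
      Lf.S = LemD1OfPlace.standingData L v cc N J (complexConj_imagUnit L) (imagUnit_ne_zero L) hN hJh hJdet ∧
      (∀ i, (Lf.eps i).1 = LemD1OfPlace.eps L v (imagUnit_ne_zero L)) ∧ (∀ i, (Lf.chi i).1 = 1) ∧
      (Lf.mu 0).1 = localMu L (toHeckeCharacter L ψ) v ∧
      (Lf.mu 1).1 (LemD1OfPlace.eps L v (imagUnit_ne_zero L)) =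
        -localMu L (toHeckeCharacter L ψ) v (LemD1OfPlace.eps L v (imagUnit_ne_zero L)) ∧
      Lf.Item1AsPrinted ∧ LemD1_3AsPrintedI Lf ∧
      Lf.mu 0 ≠ Lf.mu 1 ∧ LemD1.SameClass (Lf.eps 0) (Lf.eps 1) ∧ Lf.chi 0 = Lf.chi 1 ∧
      ¬ AreIsomorphicRep (Lf.quot 1) (Lf.quot 0) :=
  exists_lemD1IndexedFamily_item1_and_lemD1_3_mu_of_wild L v cc (complexConj_imagUnit L) (imagUnit_ne_zero L) N J hN hJh hJdet
    w hwN h3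
    (LemD1OfPlace.muOf L v cc N J (complexConj_imagUnit L) (imagUnit_ne_zero L) hN hJh hJdet
      (localMu L (toHeckeCharacter L ψ) v)
      (fun x => norm_localMu L (toHeckeCharacter L ψ) v (isUnitary_toHeckeCharacter L ψ) x)
      (continuous_localMu L (toHeckeCharacter L ψ) v)
      (fun t => localMu_toLocalRing_eq_one_iff L (toHeckeCharacter L ψ) v
        ((isOscillatorChar_toHeckeCharacter_iff ψ).mpr hψ) t))
    (LemD1OfPlace.epsDelta L v cc N J (complexConj_imagUnit L) (imagUnit_ne_zero L) hN hJh hJdet)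

/-- **the records `hD1''` ∕ `hD3` read at the rows' slot types do not force «same `ε`-class and same `χ` ⟹ same `μ`»** — ANY CM field,
every place `w ∣ v` with `v_w(N) < 1`, every `N ≥ 3`. [cite: Liu2021, App. D Lemma D.1 (1) and (3) (l. 5229, 5233)] -/
theorem not_forall_mu_eq_of_sameClass_of_chi_eq_of_isCMField_of_wild (w : PlacesOver L v)
    (hwN : Valued.v ((N : w.1.adicCompletion L)) < 1) (h3 : 3 ≤ N) :
    ¬ ∀ Lf : LemD1IndexedFamily (v.adicCompletion L⁺) (LocalRing L v) N (Fin 2),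
        Lf.S = LemD1OfPlace.standingData L v cc N J (complexConj_imagUnit L) (imagUnit_ne_zero L) hN hJh hJdet →
        Lf.Item1AsPrinted → LemD1_3AsPrintedI Lf →
        ∀ i j : Fin 2, LemD1.SameClass (Lf.eps i) (Lf.eps j) → Lf.chi i = Lf.chi j → Lf.mu i = Lf.mu j :=
  not_forall_mu_eq_of_sameClass_of_chi_eq_of_wild L v cc (complexConj_imagUnit L) (imagUnit_ne_zero L) N J hN hJh hJdet w hwN h3

/-- **… nor «same central character ⟹ isomorphic carriers»** (same hypotheses). [cite: Liu2021, App. D Lemma D.1 (1) and (3) (l. 5229, 5233)] -/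
theorem not_forall_areIsomorphicRep_of_chi_eq_of_isCMField_of_wild (w : PlacesOver L v)
    (hwN : Valued.v ((N : w.1.adicCompletion L)) < 1) (h3 : 3 ≤ N) :
    ¬ ∀ Lf : LemD1IndexedFamily (v.adicCompletion L⁺) (LocalRing L v) N (Fin 2),
        Lf.S = LemD1OfPlace.standingData L v cc N J (complexConj_imagUnit L) (imagUnit_ne_zero L) hN hJh hJdet →
        Lf.Item1AsPrinted → LemD1_3AsPrintedI Lf →
        ∀ i j : Fin 2, Lf.chi i = Lf.chi j → AreIsomorphicRep (Lf.quot j) (Lf.quot i) :=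
  not_forall_areIsomorphicRep_of_chi_eq_of_wild L v cc (complexConj_imagUnit L) (imagUnit_ne_zero L) N J hN hJh hJdet w hwN h3

omit [IsCMField L] in
/-- `v_w(N) < 1` at a place `w` of `L` above `3` when `3 ∣ N`. [folklore] -/
private theorem valued_natCast_lt_one_of_three_dvd (w : HeightOneSpectrum (𝓞 L)) {N : ℕ} (h3N : 3 ∣ N)
    (h3w : (3 : 𝓞 L) ∈ w.asIdeal) : Valued.v ((N : w.adicCompletion L)) < 1 := by
  obtain ⟨k, rfl⟩ := h3N
  have h3 : Valued.v ((3 : ℕ) : w.adicCompletion L) < 1 := by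
    rw [← map_natCast (algebraMap L (w.adicCompletion L)) 3]
    change Valued.v ((((3 : ℕ) : L)) : w.adicCompletion L) < 1
    rw [HeightOneSpectrum.valuedAdicCompletion_eq_valuation', Nat.cast_ofNat,
      show (3 : L) = algebraMap (𝓞 L) L 3 from (map_ofNat (algebraMap (𝓞 L) L) 3).symm,
      HeightOneSpectrum.valuation_lt_one_iff_mem]
    exact h3w
  rw [Nat.cast_mul, Valuation.map_mul, mul_comm]
  exact mul_lt_of_le_one_of_lt (valued_natCast_le_one w k) h3

/-- **THE END's CASE ABOVE `3`**: ANY CM field `L`, `3 ∣ N`, every place `w` of `L` ABOVE `3` (`(3) ⊆ w`): the records `hD1''` ∕ `hD3` do not force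
«same `ε`-class ∧ same `χ` ⟹ same `μ`» there — the places left out by `…TorsionCarrier`'s cube-root theorem.
[cite: Liu2021, App. D Lemma D.1 (1) and (3) (l. 5229, 5233)] -/
theorem not_forall_mu_eq_of_sameClass_of_chi_eq_of_isCMField_of_three_mem (w : PlacesOver L v) (h3N : 3 ∣ N)
    (h3w : (3 : 𝓞 L) ∈ w.1.asIdeal) (h3 : 3 ≤ N) :
    ¬ ∀ Lf : LemD1IndexedFamily (v.adicCompletion L⁺) (LocalRing L v) N (Fin 2),
        Lf.S = LemD1OfPlace.standingData L v cc N J (complexConj_imagUnit L) (imagUnit_ne_zero L) hN hJh hJdet →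
        Lf.Item1AsPrinted → LemD1_3AsPrintedI Lf →
        ∀ i j : Fin 2, LemD1.SameClass (Lf.eps i) (Lf.eps j) → Lf.chi i = Lf.chi j → Lf.mu i = Lf.mu j :=
  not_forall_mu_eq_of_sameClass_of_chi_eq_of_isCMField_of_wild L v N J hN hJh hJdet w
    (valued_natCast_lt_one_of_three_dvd L w.1 h3N h3w) h3

/-- **… nor «same central character ⟹ isomorphic carriers»** above `3` (`3 ∣ N`). [cite: Liu2021, App. D Lemma D.1 (1) and (3) (l. 5229, 5233)] -/
theorem not_forall_areIsomorphicRep_of_chi_eq_of_isCMField_of_three_mem (w : PlacesOver L v) (h3N : 3 ∣ N)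
    (h3w : (3 : 𝓞 L) ∈ w.1.asIdeal) (h3 : 3 ≤ N) :
    ¬ ∀ Lf : LemD1IndexedFamily (v.adicCompletion L⁺) (LocalRing L v) N (Fin 2),
        Lf.S = LemD1OfPlace.standingData L v cc N J (complexConj_imagUnit L) (imagUnit_ne_zero L) hN hJh hJdet →
        Lf.Item1AsPrinted → LemD1_3AsPrintedI Lf →
        ∀ i j : Fin 2, Lf.chi i = Lf.chi j → AreIsomorphicRep (Lf.quot j) (Lf.quot i) :=
  not_forall_areIsomorphicRep_of_chi_eq_of_isCMField_of_wild L v N J hN hJh hJdet w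
    (valued_natCast_lt_one_of_three_dvd L w.1 h3N h3w) h3

/-! ## §5 Synthesis with `…TorsionCarrier`: a CM field containing `ζ_3`, `3 ∣ N` — EVERY finite place of `L⁺` -/

/-- **EVERY finite place `v` of `L⁺`** — `L` a CM field containing a primitive cube root of unity `ζ` (`ζ² + ζ + 1 = 0`), `3 ∣ N`, `N ≥ 3`
(the END's rank is `3`): the records `hD1''` ∕ `hD3` read at the rows' slot types do NOT force «same `ε`-class ∧ same `χ` ⟹ same `μ`» at ANY
place: above `3` by §4 (the wild carrier), away from `3` by `…TorsionCarrier.not_forall_mu_eq_of_sameClass_of_chi_eq_of_isCMField_of_cubeRoot`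
(the torsion carrier), the split places being served inside both by `…DetCarrier`.  So for such `L` the `μ`-conjunct of [Lem. D.1 (3)] AS
PRINTED is independent of the `(ε, χ)`-conjuncts EVERYWHERE. [cite: Liu2021, App. D Lemma D.1 (1) and (3) (l. 5229, 5233)] -/
theorem forall_not_forall_mu_eq_of_sameClass_of_chi_eq_of_isCMField_of_cubeRoot (ζ : L) (hζ : ζ ^ 2 + ζ + 1 = 0) (h3N : 3 ∣ N)
    (h3 : 3 ≤ N) :
    ∀ v : HeightOneSpectrum (𝓞 L⁺),
      ¬ ∀ Lf : LemD1IndexedFamily (v.adicCompletion L⁺) (LocalRing L v) N (Fin 2),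
          Lf.S = LemD1OfPlace.standingData L v cc N J (complexConj_imagUnit L) (imagUnit_ne_zero L) hN hJh hJdet →
          Lf.Item1AsPrinted → LemD1_3AsPrintedI Lf →
          ∀ i j : Fin 2, LemD1.SameClass (Lf.eps i) (Lf.eps j) → Lf.chi i = Lf.chi j → Lf.mu i = Lf.mu j := by
  intro v
  obtain ⟨w⟩ := (inferInstance : Nonempty (PlacesOver L v))
  by_cases h3w : (3 : 𝓞 L) ∈ w.1.asIdeal
  · exact not_forall_mu_eq_of_sameClass_of_chi_eq_of_isCMField_of_three_mem L v N J hN hJh hJdet w h3N h3w h3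
  · exact LemD1IndexedNonVacuityTorsionCarrier.not_forall_mu_eq_of_sameClass_of_chi_eq_of_isCMField_of_cubeRoot L v N J hN hJh
      hJdet w ζ hζ h3N h3w h3

/-- **… nor «same central character ⟹ isomorphic carriers», at EVERY finite place of `L⁺`** (`ζ_3 ∈ L`, `3 ∣ N`, `N ≥ 3`).
[cite: Liu2021, App. D Lemma D.1 (1) and (3) (l. 5229, 5233)] -/
theorem forall_not_forall_areIsomorphicRep_of_chi_eq_of_isCMField_of_cubeRoot (ζ : L) (hζ : ζ ^ 2 + ζ + 1 = 0) (h3N : 3 ∣ N)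
    (h3 : 3 ≤ N) :
    ∀ v : HeightOneSpectrum (𝓞 L⁺),
      ¬ ∀ Lf : LemD1IndexedFamily (v.adicCompletion L⁺) (LocalRing L v) N (Fin 2),
          Lf.S = LemD1OfPlace.standingData L v cc N J (complexConj_imagUnit L) (imagUnit_ne_zero L) hN hJh hJdet →
          Lf.Item1AsPrinted → LemD1_3AsPrintedI Lf →
          ∀ i j : Fin 2, Lf.chi i = Lf.chi j → AreIsomorphicRep (Lf.quot j) (Lf.quot i) := by
  intro v
  obtain ⟨w⟩ := (inferInstance : Nonempty (PlacesOver L v))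
  by_cases h3w : (3 : 𝓞 L) ∈ w.1.asIdeal
  · exact not_forall_areIsomorphicRep_of_chi_eq_of_isCMField_of_three_mem L v N J hN hJh hJdet w h3N h3w h3
  · exact LemD1IndexedNonVacuityTorsionCarrier.not_forall_areIsomorphicRep_of_chi_eq_of_isCMField_of_cubeRoot L v N J hN hJh
      hJdet w ζ hζ h3N h3w h3

end CM

end Literature.NumberTheory.Automorphic.Liu2021.LemD1IndexedNonVacuityWildCarrier

end
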